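import Literature.NumberTheory.EllipticCurves.FormalGroupChart
import HarnessLib

/-! # Linearity of `z = -x/y` along multiples in the kernel of reduction — stub `stub_lineMul`
# of line `Sketch`, crux `MazurKenkuBound` (stmt-ABC-15125)

WHAT. For a `w`-integral Weierstrass equation `V` over a valued field `(F, w)`, a point `P` of the
kernel of reduction `E₁ = FormalGroupChart.kernel w V` and `1 ≤ a` with `|b| = 1` for all
`1 ≤ b ≤ a`: `aP ∈ E₁`, `|z(aP)| = |z(P)|` and `|z(aP) - a·z(P)| ≤ |z(P)|²` — the first-order
expansion `[a](z) = az + O(z²)` of the multiplication-by-`a` map of the formal group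
(Silverman, *AEC* IV.1 and Prop. VII.2.2), in the power-series-free language of the tree file
`Literature.NumberTheory.EllipticCurves.FormalGroupChart`.

PROOF. Membership of every multiple is `AddSubgroup.nsmul_mem`. The two estimates by induction on
`a`, iterating the tree's first-order additivity `FormalGroupChart.val_zCoord_add_sub_le`
(`|z(P + Q) - z(P) - z(Q)| ≤ max(|z(P)|, |z(Q)|)²`): with `Q = aP`,
`z((a+1)P) - (a+1)z(P) = (z(Q + P) - z(Q) - z(P)) + (z(Q) - a z(P))`, both summands of size
`≤ |z(P)|²` by the induction hypothesis `|z(Q)| = |z(P)|`; and `|z((a+1)P)| = |z(P)|` because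
`|(a+1) z(P)| = |z(P)| > |z(P)|² ≥ |z((a+1)P) - (a+1)z(P)|` (`|a+1| = 1`, `0 < |z(P)| < 1`; the
point `P = O`, where `z = 0` throughout, is treated apart).
-/

-- `Summit.<Summit>.<Problem>` is the mandated summit-side namespace (CONVENTIONS §2); for the
-- single-conjunct summit `ABC` the two coincide, so the duplicate `ABC.ABC` is deliberate.
set_option linter.dupNamespace false

noncomputable section

open scoped NNReal Classical

open WeierstrassCurve Literature.NumberTheory.EllipticCurves

namespace Summit.ABC.ABC.Theorems

/-- **Linearity of `z` along multiples in the kernel of reduction**: for a point `P` of the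
kernel of reduction `E₁` of a `w`-integral Weierstrass equation over a valued field and `1 ≤ a`
with `|b| = 1` for `1 ≤ b ≤ a`, the multiple `aP` lies in `E₁`, `|z(aP)| = |z(P)|` and
`|z(aP) - a z(P)| ≤ |z(P)|²` (iterate `FormalGroupChart.val_zCoord_add_sub_le`; Silverman, *AEC*
IV.1: `[a](z) = az + O(z²)`, Prop. VII.2.2: `z(P + Q) = F(z(P), z(Q))` on `E₁`).
[cite: SilvermanAEC2009, IV.1 and Prop. VII.2.2] -/
theorem stub_lineMul {F : Type*} [Field F] {w : Valuation F ℝ≥0} {V : WeierstrassCurve F}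
    [V.IsIntegral w.integer] {P : V.toAffine.Point} (hP : P ∈ FormalGroupChart.kernel w V)
    {a : ℕ} (ha1 : 1 ≤ a) (ha : ∀ b : ℕ, 1 ≤ b → b ≤ a → w (b : F) = 1) :
    a • P ∈ FormalGroupChart.kernel w V ∧ w (a • P).zCoord = w P.zCoord ∧
      w ((a • P).zCoord - (a : F) * P.zCoord) ≤ w P.zCoord ^ 2 := by
  -- every multiple of `P` lies in the subgroup `E₁`
  have hmul : ∀ m : ℕ, m • P ∈ FormalGroupChart.kernel w V :=
    (FormalGroupChart.kernel w V).nsmul_mem hP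
  refine ⟨hmul a, ?_⟩
  -- The point `O`: every multiple is `O` and every parameter vanishes.
  rcases eq_or_ne P 0 with rfl | hP0
  · rw [nsmul_zero, WeierstrassCurve.Affine.Point.zCoord_zero, mul_zero, sub_self, map_zero]
    exact ⟨rfl, zero_le⟩
  -- Otherwise `0 < |z(P)| < 1`.
  have hzpos : 0 < w P.zCoord :=
    (Valuation.pos_iff w).mpr fun h ↦ hP0 ((FormalGroupChart.zCoord_eq_zero_iff hP).mp h)
  have hz1 : w P.zCoord < 1 := FormalGroupChart.val_zCoord_lt_one hP
  induction a with
  | zero => exact absurd ha1 (Nat.not_succ_le_zero 0)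
  | succ n ih =>
    rcases Nat.eq_zero_or_pos n with rfl | hn
    · -- `a = 1`
      rw [zero_add, one_nsmul, Nat.cast_one, one_mul, sub_self, map_zero]
      exact ⟨rfl, zero_le⟩
    · -- `a = n + 1` with `1 ≤ n`: write `(n + 1)P = nP + P`
      obtain ⟨hval, hlin⟩ := ih hn fun b hb1 hbn ↦ ha b hb1 (Nat.le_succ_of_le hbn)
      have hn1 : w ((n + 1 : ℕ) : F) = 1 := ha (n + 1) (Nat.succ_le_succ (Nat.zero_le n)) le_rfl
      -- first-order additivity at `(nP, P)`, using `|z(nP)| = |z(P)|`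
      have h1 : w ((n • P + P).zCoord - (n • P).zCoord - P.zCoord) ≤ w P.zCoord ^ 2 := by
        have h := FormalGroupChart.val_zCoord_add_sub_le (hmul n) hP
        rwa [hval, max_self] at h
      have hdec : ((n + 1) • P).zCoord - ((n + 1 : ℕ) : F) * P.zCoord =
          ((n • P + P).zCoord - (n • P).zCoord - P.zCoord) +
            ((n • P).zCoord - (n : F) * P.zCoord) := by
        rw [succ_nsmul]; push_cast; ring
      have h3 : w (((n + 1) • P).zCoord - ((n + 1 : ℕ) : F) * P.zCoord) ≤ w P.zCoord ^ 2 := by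
        rw [hdec]; exact w.map_add_le h1 hlin
      have hX : w (((n + 1 : ℕ) : F) * P.zCoord) = w P.zCoord := by
        rw [map_mul, hn1, one_mul]
      refine ⟨?_, h3⟩
      -- `|z((n+1)P)| = |(n+1) z(P) + (error of size ≤ |z|² < |z|)| = |z(P)|`
      have hlt : w (((n + 1) • P).zCoord - ((n + 1 : ℕ) : F) * P.zCoord) <
          w (((n + 1 : ℕ) : F) * P.zCoord) := by
        rw [hX]
        exact h3.trans_lt (by rw [sq]; exact mul_lt_of_lt_one_left hzpos hz1)
      have hsplit : ((n + 1) • P).zCoord = ((n + 1 : ℕ) : F) * P.zCoord +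
          (((n + 1) • P).zCoord - ((n + 1 : ℕ) : F) * P.zCoord) := by ring
      rw [hsplit, Valuation.map_add_eq_of_lt_left w hlt, hX]

end Summit.ABC.ABC.Theorems

end
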